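import Literature.Probability.RandomPlanarGeometry.HexSAWSurfaceWallRenewalThirteenthCensusIdentity
import Literature.Probability.RandomPlanarGeometry.HexSAWSurfaceWallRenewalCensusThirteenA
import Literature.Probability.RandomPlanarGeometry.HexSAWSurfaceWallRenewalCensusThirteenB2
import Literature.Probability.RandomPlanarGeometry.HexSAWSurfaceWallRenewalCensusThirteenC3
import Literature.Probability.RandomPlanarGeometry.HexSAWSurfaceWallRenewalCensusThirteenD7
import Literature.Probability.RandomPlanarGeometry.HexSAWSurfaceWallRenewalCensusThirteenE3
import HarnessLib

/-!
# The thirteenth-order coefficient of `β(y)²` is `−332`: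
# `y¹² (β(y)² − y − 1/y − 1/y² − 2/y³ − 4/y⁴ − 6/y⁵ − 12/y⁶ − 18/y⁷ − 15/y⁸ − 7/y⁹ + 16/y¹⁰ + 109/y¹¹) → −332`

`β(y) = wallRate y` is the exponential growth rate of wall bridges of self-avoiding walks on the brick-wall (hexagonal) lattice along a zigzag wall with
contact fugacity `y`.  «THIRTEENTH-CENSUS-IDENTITY» identifies the thirteenth coefficient with `N₁₄,₁ + N₁₅,₂ + N₁₆,₃ + N₁₇,₄ + N₁₈,₅ + N₁₉,₆ − 67555`; this
module substitutes `17356` («CENSUS-THIRTEEN-A»), `23296` («-B»), `17048` («-C»), `7839` («-D»), `1627` («-E») — the FAST counting engine — and `N₁₉,₆ = 57`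
from a-idea-1's slack-two classification (#803, `card_filter_visits_eq_slack_two` at `k = 6`: `2 + 0 + 1 + 4 + 9 + 16 + 25`):

  ★★★ `tendsto_pow_twelve_mul_wallRate_sq_sub : y¹² (β(y)² − y − … + 16/y¹⁰ + 109/y¹¹) → −332` (`y → ∞`),

i.e. **`β(y)² = y + 1/y + 1/y² + 2/y³ + 4/y⁴ + 6/y⁵ + 12/y⁶ + 18/y⁷ + 15/y⁸ + 7/y⁹ − 16/y¹⁰ − 109/y¹¹ − 332/y¹² + o(y⁻¹²)`**
(`isLittleO_wallRate_sq_sub_thirteenth`, `eventually_thirteenth_order_window`, `tendsto_pow_twelve_mul_wallRate_sq_sub_unique`, `thirteenth_coefficient_neg`).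

HONEST LABEL.  LANE THEOREM, DERIVED (one-line assembly); NEW IN WRITING (modest).  Print: `β ∼ √y` ([BeatonBousquetMelouDeGierDuminilCopinGuttmann2014, §3.1, Proposition 5, p. 10]),
renewal structure ([MadrasSlade1993, §4.2], [Kesten1963SAW, §4]).  NOT CLAIMED: `a₁₃`, any rate, anything for `y ≤ μ³`.  No definitions.
-/

namespace Literature.Probability.RandomPlanarGeometry.SAW.HexBW.Wall

open Finset Filter Function
open Literature.Probability.LatticeModels
open _root_.Topology Asymptotics

variable {y : ℝ}

/-- [folklore] Relabel the limit of a `Tendsto` by an equal constant. -/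
private theorem tendsto_of_tendsto_of_eq_ty {f : ℝ → ℝ} {L c : ℝ} (h : Tendsto f atTop (𝓝 L)) (e : L = c) :
    Tendsto f atTop (𝓝 c) := e ▸ h

open Classical in
/-- `N₁₉,₆ = 57` at the numeral length (a-idea-1's slack-two classification, #803: `2 + Σ_{j<6} j²`). [cite: MadrasSlade1993, Section 4.2, (4.2.2)] -/
theorem card_sixVisit_ipwb_thirtyeight_eq {m : ℕ} (hm : m = 38) : #((ipwb m).filter fun ω => visits m ω = 6) = 57 := by
  rw [card_filter_visits_eq_slack_two (k := 6) (by norm_num) (by omega)]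
  decide

/-- ★★★ **THE THIRTEENTH-ORDER COEFFICIENT OF `β(y)²` IS `−332`:**
`y¹² (β(y)² − y − … + 16/y¹⁰ + 109/y¹¹) → −332` as `y → ∞` — the census identity with `17356 + 23296 + 17048 + 7839 + 1627 + 57 = 67223` and `67223 − 67555 = −332`.
[cite: BeatonBousquetMelouDeGierDuminilCopinGuttmann2014, Section 3.1, Proposition 5 (arXiv v5 p. 9); p. 10] [cite: Kesten1963SAW, Section 4] [cite: MadrasSlade1993, Section 4.2, (4.2.4), Theorem 4.2.2 (pp. 91–92)] -/
theorem tendsto_pow_twelve_mul_wallRate_sq_sub :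
    Tendsto (fun y : ℝ => y ^ 12 * (wallRate y ^ 2 - y - 1 / y - 1 / y ^ 2 - 2 / y ^ 3 - 4 / y ^ 4 - 6 / y ^ 5 - 12 / y ^ 6 - 18 / y ^ 7 - 15 / y ^ 8 -
      7 / y ^ 9 + 16 / y ^ 10 + 109 / y ^ 11)) atTop (𝓝 (-332)) := by
  classical
  have h := tendsto_pow_twelve_mul_wallRate_sq_sub_census (m₁ := 28) (m₂ := 30) (m₃ := 32) (m₄ := 34) (m₅ := 36) (m₆ := 38) rfl rfl rfl rfl rfl rfl
  rw [card_oneVisit_ipwb_twentyeight_eq rfl, card_twoVisit_ipwb_thirty_eq rfl, card_threeVisit_ipwb_thirtytwo_eq rfl,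
    card_fourVisit_ipwb_thirtyfour_eq rfl, card_fiveVisit_ipwb_thirtysix_eq rfl, card_sixVisit_ipwb_thirtyeight_eq rfl] at h
  exact tendsto_of_tendsto_of_eq_ty h (by norm_num)

/-- ★★★ Landau form: `β(y)² − (y + 1/y + … − 16/y¹⁰ − 109/y¹¹ − 332/y¹²) = o(y⁻¹²)` as `y → ∞`.
[cite: BeatonBousquetMelouDeGierDuminilCopinGuttmann2014, Section 3.1, Proposition 5 (arXiv v5 p. 9)] -/
theorem isLittleO_wallRate_sq_sub_thirteenth :
    (fun y : ℝ => wallRate y ^ 2 - (y + 1 / y + 1 / y ^ 2 + 2 / y ^ 3 + 4 / y ^ 4 + 6 / y ^ 5 + 12 / y ^ 6 + 18 / y ^ 7 + 15 / y ^ 8 + 7 / y ^ 9 - 16 / y ^ 10 -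
      109 / y ^ 11 - 332 / y ^ 12)) =o[atTop] fun y : ℝ => 1 / y ^ 12 := by
  have h0 : Tendsto (fun y : ℝ => y ^ 12 * (wallRate y ^ 2 - y - 1 / y - 1 / y ^ 2 - 2 / y ^ 3 - 4 / y ^ 4 - 6 / y ^ 5 - 12 / y ^ 6 - 18 / y ^ 7 - 15 / y ^ 8 -
      7 / y ^ 9 + 16 / y ^ 10 + 109 / y ^ 11) - (-332)) atTop (𝓝 0) := by
    simpa using tendsto_pow_twelve_mul_wallRate_sq_sub.sub_const (-332)
  have h1 : (fun y : ℝ => y ^ 12 * (wallRate y ^ 2 - y - 1 / y - 1 / y ^ 2 - 2 / y ^ 3 - 4 / y ^ 4 - 6 / y ^ 5 - 12 / y ^ 6 - 18 / y ^ 7 - 15 / y ^ 8 -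
      7 / y ^ 9 + 16 / y ^ 10 + 109 / y ^ 11) - (-332)) =o[atTop] fun _ : ℝ => (1 : ℝ) := (isLittleO_one_iff ℝ).2 h0
  have h2 := h1.mul_isBigO (isBigO_refl (fun y : ℝ => 1 / y ^ 12) atTop)
  refine (h2.congr' ?_ ?_)
  · filter_upwards [eventually_gt_atTop (0 : ℝ)] with y hy
    field_simp
    ring
  · exact Eventually.of_forall fun y => by simp

/-- ★★ Two-sided eventual form: for every `δ > 0`, eventually
`y + 1/y + … − 109/y¹¹ + (−332 − δ)/y¹² ≤ β(y)² ≤ y + 1/y + … − 109/y¹¹ + (−332 + δ)/y¹²`.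
[cite: BeatonBousquetMelouDeGierDuminilCopinGuttmann2014, Section 3.1, Proposition 5 (arXiv v5 p. 9)] -/
theorem eventually_thirteenth_order_window {δ : ℝ} (hδ : 0 < δ) :
    ∀ᶠ y : ℝ in atTop, y + 1 / y + 1 / y ^ 2 + 2 / y ^ 3 + 4 / y ^ 4 + 6 / y ^ 5 + 12 / y ^ 6 + 18 / y ^ 7 + 15 / y ^ 8 + 7 / y ^ 9 - 16 / y ^ 10 - 109 / y ^ 11 +
        (-332 - δ) / y ^ 12 ≤ wallRate y ^ 2 ∧
      wallRate y ^ 2 ≤ y + 1 / y + 1 / y ^ 2 + 2 / y ^ 3 + 4 / y ^ 4 + 6 / y ^ 5 + 12 / y ^ 6 + 18 / y ^ 7 + 15 / y ^ 8 + 7 / y ^ 9 - 16 / y ^ 10 - 109 / y ^ 11 +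
        (-332 + δ) / y ^ 12 := by
  have h := tendsto_pow_twelve_mul_wallRate_sq_sub
  have hlo := h.eventually (eventually_gt_nhds (show (-332 : ℝ) - δ < -332 by linarith))
  have hhi := h.eventually (eventually_lt_nhds (show (-332 : ℝ) < -332 + δ by linarith))
  filter_upwards [hlo, hhi, eventually_gt_atTop (0 : ℝ)] with y h1 h2 hy
  have hy8 : 0 < y ^ 12 := pow_pos hy 12
  have e2 : wallRate y ^ 2 = (y + 1 / y + 1 / y ^ 2 + 2 / y ^ 3 + 4 / y ^ 4 + 6 / y ^ 5 + 12 / y ^ 6 + 18 / y ^ 7 + 15 / y ^ 8 + 7 / y ^ 9 - 16 / y ^ 10 - 109 / y ^ 11) +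
      (y ^ 12 * (wallRate y ^ 2 - y - 1 / y - 1 / y ^ 2 - 2 / y ^ 3 - 4 / y ^ 4 - 6 / y ^ 5 - 12 / y ^ 6 - 18 / y ^ 7 - 15 / y ^ 8 -
      7 / y ^ 9 + 16 / y ^ 10 + 109 / y ^ 11)) / y ^ 12 := by
    field_simp
    ring
  have elo : y + 1 / y + 1 / y ^ 2 + 2 / y ^ 3 + 4 / y ^ 4 + 6 / y ^ 5 + 12 / y ^ 6 + 18 / y ^ 7 + 15 / y ^ 8 + 7 / y ^ 9 - 16 / y ^ 10 - 109 / y ^ 11 + (-332 - δ) / y ^ 12 =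
      (y + 1 / y + 1 / y ^ 2 + 2 / y ^ 3 + 4 / y ^ 4 + 6 / y ^ 5 + 12 / y ^ 6 + 18 / y ^ 7 + 15 / y ^ 8 + 7 / y ^ 9 - 16 / y ^ 10 - 109 / y ^ 11) + (-332 - δ) / y ^ 12 := by
    ring
  have ehi : y + 1 / y + 1 / y ^ 2 + 2 / y ^ 3 + 4 / y ^ 4 + 6 / y ^ 5 + 12 / y ^ 6 + 18 / y ^ 7 + 15 / y ^ 8 + 7 / y ^ 9 - 16 / y ^ 10 - 109 / y ^ 11 + (-332 + δ) / y ^ 12 =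
      (y + 1 / y + 1 / y ^ 2 + 2 / y ^ 3 + 4 / y ^ 4 + 6 / y ^ 5 + 12 / y ^ 6 + 18 / y ^ 7 + 15 / y ^ 8 + 7 / y ^ 9 - 16 / y ^ 10 - 109 / y ^ 11) + (-332 + δ) / y ^ 12 := by
    ring
  rw [elo, ehi, e2]
  constructor
  · gcongr
  · gcongr

/-- ★ Uniqueness form: any limit of `y¹² (β(y)² − y − … + 109/y¹¹)` equals `−332`. [cite: MadrasSlade1993, Section 4.2, Theorem 4.2.2 (pp. 91–92)] -/
theorem tendsto_pow_twelve_mul_wallRate_sq_sub_unique {L : ℝ}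
    (h : Tendsto (fun y : ℝ => y ^ 12 * (wallRate y ^ 2 - y - 1 / y - 1 / y ^ 2 - 2 / y ^ 3 - 4 / y ^ 4 - 6 / y ^ 5 - 12 / y ^ 6 - 18 / y ^ 7 - 15 / y ^ 8 -
      7 / y ^ 9 + 16 / y ^ 10 + 109 / y ^ 11)) atTop (𝓝 L)) :
    L = -332 :=
  tendsto_nhds_unique h tendsto_pow_twelve_mul_wallRate_sq_sub

/-- ★★ **The thirteenth coefficient is negative too** (sequence `1, 1, 2, 4, 6, 12, 18, 15, 7, −16, −109, −332`).
[cite: BeatonBousquetMelouDeGierDuminilCopinGuttmann2014, Section 3.1, Proposition 5 (arXiv v5 p. 9); p. 10] -/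
theorem thirteenth_coefficient_neg {L : ℝ}
    (h : Tendsto (fun y : ℝ => y ^ 12 * (wallRate y ^ 2 - y - 1 / y - 1 / y ^ 2 - 2 / y ^ 3 - 4 / y ^ 4 - 6 / y ^ 5 - 12 / y ^ 6 - 18 / y ^ 7 - 15 / y ^ 8 -
      7 / y ^ 9 + 16 / y ^ 10 + 109 / y ^ 11)) atTop (𝓝 L)) : L < 0 := by
  rw [tendsto_pow_twelve_mul_wallRate_sq_sub_unique h]
  norm_num

end Literature.Probability.RandomPlanarGeometry.SAW.HexBW.Wall
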